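import Summits.QuantumFields.YangMills.Theorems.ColdStartUniversalityLatticeLangevinDynkinSZZ
import Summits.QuantumFields.YangMills.Theorems.ColdStartUniversalityLatticeLangevinLatitudeODE
import Summits.QuantumFields.YangMills.Theorems.ColdStartUniversalityLatticeLangevinFeller
import Mathlib.Analysis.Calculus.BumpFunction.FiniteDimension
import Mathlib.Analysis.CStarAlgebra.Matrix
import HarnessLib

/-!
# Route `ColdStartUniversality`, crux K_A1 `UniformColdStartMixing` (stmt-QuantumFields-24809), rung `stub_fixedCutoffMixing`:
# closed-form expectations of latitude eigenfunctions along the `β' = 0` SU(2) lattice Langevin dynamics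

Helper file (seat `ym-line-csu-p1`, g7).  The `β' = 0` SZZ dynamics is Brownian motion on `SU(2)^E` (generator `Σ_e Δ_e`
in the normalisation of `latticeLangevinDynamics`).  For directions `g : Edge 3 L → SU(2)` and degrees `m : Edge 3 L → ℕ`
the latitude eigenfunction `V ↦ ∏_e U_{m_e}(⟨ρ(g_e), ρ(V_e)⟩)`, `⟨X, Y⟩ = ½ Re tr(X Yᴴ)`, `U_n = C_n^{(1)}` the
Chebyshev polynomial of the second kind (`gegenbauerSum 1 n`), has

  `E ∏_e U_{m_e}(⟨ρ(g_e), ρ(U^x_t(e))⟩) = exp(-t Σ_e m_e(m_e+2)/2) ∏_e U_{m_e}(⟨ρ(g_e), ρ(x_e)⟩)`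

for every solution family `U` from every start with the regular-flow measurability clause (`integral_prod_gegenbauer_latitude`).
Proof: Dynkin's formula (`dynkin_expectation_szz`) for a compactly supported cut-off of the eigenfunction, the generator
on latitude functions (`generator_latitude`), the eigenfunction identity (`jacobi_prod_gegenbauer`), Fubini, and the
linear ODE in integral form (`eq_mul_exp_of_integral_eq`).  This is the harmonic-analysis engine of the g7 route to the
Doeblin minorisation (D) of the rung: it determines the law of the Brownian motion on `SU(2)^E` on all ridge polynomials
WITHOUT heat kernels.  No definition, no sorry.  RECORD-rung R3 plumbing; nothing here bears on the mass gap.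
-/

set_option autoImplicit false

noncomputable section

namespace Summit.QuantumFields.YangMills.Theorems.ColdStartUniversality

open MeasureTheory Finset Set Filter
open scoped BigOperators Topology NNReal
open Literature.MathematicalPhysics.QuantumFieldTheory
open Literature.MathematicalPhysics.QuantumLattice (fundamentalRep fundamentalLatticeRep)
open Literature.Analysis.SpecialFunctions (gegenbauerSum)

variable {L : ℕ} [NeZero L]

/-- The real link coordinates of an `SU(2)` configuration have sup norm `≤ 1` (entries of unitary matrices have norm
`≤ 1`). [folklore] -/
theorem norm_coords_le_one (V : GaugeConfig 3 L (Matrix.specialUnitaryGroup (Fin 2) ℂ)) :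
    ‖(fun q : Edge 3 L × Fin 2 × Fin 2 × Bool =>
      if q.2.2.2 = true then ((fundamentalRep (Fin 2) (V q.1) : Matrix (Fin 2) (Fin 2) ℂ) q.2.1 q.2.2.1).im
      else ((fundamentalRep (Fin 2) (V q.1) : Matrix (Fin 2) (Fin 2) ℂ) q.2.1 q.2.2.1).re)‖ ≤ 1 := by
  refine (pi_norm_le_iff_of_nonneg zero_le_one).2 fun q => ?_
  have hU : ((fundamentalRep (Fin 2) (V q.1) : Matrix (Fin 2) (Fin 2) ℂ)) ∈ Matrix.unitaryGroup (Fin 2) ℂ :=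
    Matrix.specialUnitaryGroup_le_unitaryGroup (V q.1).2
  have h := entry_norm_bound_of_unitary hU q.2.1 q.2.2.1
  rw [Real.norm_eq_abs]
  split_ifs
  · exact (Complex.abs_im_le_norm _).trans h
  · exact (Complex.abs_re_le_norm _).trans h

/-- The latitude observable `V ↦ ∏_e U_{m_e}(⟨ρ g_e, ρ V_e⟩)` is continuous. [folklore] -/
theorem continuous_prod_gegenbauer_latitude (g : Edge 3 L → Matrix.specialUnitaryGroup (Fin 2) ℂ) (m : Edge 3 L → ℕ) :
    Continuous fun V : GaugeConfig 3 L (Matrix.specialUnitaryGroup (Fin 2) ℂ) =>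
      ∏ e, gegenbauerSum 1 (m e) (hsForm 2 (fundamentalRep (Fin 2) (g e)) (fundamentalRep (Fin 2) (V e)) / 2) := by
  refine continuous_finsetProd _ fun e _ => (Literature.Analysis.SpecialFunctions.continuous_gegenbauerSum 1 (m e)).comp ?_
  refine Continuous.div_const ?_ _
  have hc : Continuous fun V : GaugeConfig 3 L (Matrix.specialUnitaryGroup (Fin 2) ℂ) =>
      (fundamentalRep (Fin 2) (V e) : Matrix (Fin 2) (Fin 2) ℂ) :=
    (Literature.MathematicalPhysics.QuantumLattice.continuous_fundamentalRep (n := Fin 2)).comp (continuous_apply e)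
  simp_rw [hsForm_eq_sum_entries]
  refine continuous_finsetSum _ fun i _ => continuous_finsetSum _ fun j _ => ?_
  exact Complex.continuous_re.comp (continuous_const.mul (Complex.continuous_conj.comp
    ((continuous_apply j).comp ((continuous_apply i).comp hc))))

/-- **Closed-form expectations of latitude eigenfunctions along the `β' = 0` dynamics** (Brownian motion on `SU(2)^E`):
`E ∏_e U_{m_e}(⟨ρ g_e, ρ U^x_t(e)⟩) = e^{-t Σ_e m_e(m_e+2)/2} ∏_e U_{m_e}(⟨ρ g_e, ρ x_e⟩)` for every solution family from
every start with the regular-flow measurability clause (e.g. `exists_regularFlow`). [folklore] -/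
theorem integral_prod_gegenbauer_latitude {Ω : Type} [MeasurableSpace Ω] {P : Measure Ω}
    [IsProbabilityMeasure P] {W : ℝ≥0 → Ω → (Edge 3 L × NoiseIdx 2 → ℝ)} (hW : IsFlatBrownian W P)
    (U : GaugeConfig 3 L (Matrix.specialUnitaryGroup (Fin 2) ℂ) → ℝ≥0 → Ω →
      GaugeConfig 3 L (Matrix.specialUnitaryGroup (Fin 2) ℂ))
    (hU : ∀ x, (∀ ω, U x 0 ω = x) ∧
      (latticeLangevinDynamics (fundamentalLatticeRep 2) 0).IsSolution (fundamentalRep (Fin 2))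
        hW.natFiltration P W (U x))
    (hUm : ∀ i : ℝ≥0, Measurable[@Prod.instMeasurableSpace (Set.Iic i)
        (GaugeConfig 3 L (Matrix.specialUnitaryGroup (Fin 2) ℂ) × Ω) inferInstance
        (@Prod.instMeasurableSpace (GaugeConfig 3 L (Matrix.specialUnitaryGroup (Fin 2) ℂ)) Ω inferInstance
          (hW.natFiltration i))]
      (fun q : Set.Iic i × (GaugeConfig 3 L (Matrix.specialUnitaryGroup (Fin 2) ℂ) × Ω) => U q.2.1 q.1 q.2.2))
    (x : GaugeConfig 3 L (Matrix.specialUnitaryGroup (Fin 2) ℂ))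
    (g : Edge 3 L → Matrix.specialUnitaryGroup (Fin 2) ℂ) (m : Edge 3 L → ℕ) (t : ℝ≥0) :
    ∫ ω, ∏ e, gegenbauerSum 1 (m e) (hsForm 2 (fundamentalRep (Fin 2) (g e)) (fundamentalRep (Fin 2) (U x t ω e)) / 2) ∂P
      = Real.exp (-(∑ e, (m e : ℝ) * ((m e : ℝ) + 2) / 2) * t) *
        ∏ e, gegenbauerSum 1 (m e) (hsForm 2 (fundamentalRep (Fin 2) (g e)) (fundamentalRep (Fin 2) (x e)) / 2) := by
  classical
  haveI := secondCountableTopology_su2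
  haveI := borelSpace_config L
  -- the objects
  set lam : ℝ := ∑ e, (m e : ℝ) * ((m e : ℝ) + 2) / 2 with hlam
  set Φ : (Edge 3 L → ℝ) → ℝ := fun s => ∏ e, gegenbauerSum 1 (m e) (s e) with hΦ
  set Lat : GaugeConfig 3 L (Matrix.specialUnitaryGroup (Fin 2) ℂ) → (Edge 3 L → ℝ) := fun V e =>
    hsForm 2 (fundamentalRep (Fin 2) (g e)) (fundamentalRep (Fin 2) (V e)) / 2 with hLat
  set Obs : GaugeConfig 3 L (Matrix.specialUnitaryGroup (Fin 2) ℂ) → ℝ := fun V => Φ (Lat V) with hObs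
  set lat : ((Edge 3 L × Fin 2 × Fin 2 × Bool) → ℝ) → (Edge 3 L → ℝ) := fun y e =>
    (∑ i, ∑ j, (((fundamentalRep (Fin 2) (g e) : Matrix (Fin 2) (Fin 2) ℂ) i j).re * y (e, i, j, false) +
      ((fundamentalRep (Fin 2) (g e) : Matrix (Fin 2) (Fin 2) ℂ) i j).im * y (e, i, j, true))) / 2 with hlat
  set coords : GaugeConfig 3 L (Matrix.specialUnitaryGroup (Fin 2) ℂ) → ((Edge 3 L × Fin 2 × Fin 2 × Bool) → ℝ) :=
    fun V q => if q.2.2.2 = true then ((fundamentalRep (Fin 2) (V q.1) : Matrix (Fin 2) (Fin 2) ℂ) q.2.1 q.2.2.1).im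
      else ((fundamentalRep (Fin 2) (V q.1) : Matrix (Fin 2) (Fin 2) ℂ) q.2.1 q.2.2.1).re with hcoords
  let χ : ContDiffBump (0 : (Edge 3 L × Fin 2 × Fin 2 × Bool) → ℝ) := ⟨2, 3, by norm_num, by norm_num⟩
  set f₀ : ((Edge 3 L × Fin 2 × Fin 2 × Bool) → ℝ) → ℝ := fun y => Φ (lat y) with hf₀
  set f : ((Edge 3 L × Fin 2 × Fin 2 × Bool) → ℝ) → ℝ := fun y => (χ : ((Edge 3 L × Fin 2 × Fin 2 × Bool) → ℝ) → ℝ) y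
    * Φ (lat y) with hf
  -- smoothness
  have hΦs : ContDiff ℝ 3 Φ :=
    contDiff_prod (fun e _ => (contDiff_gegenbauerSum 1 (m e)).comp (contDiff_apply ℝ ℝ e))
  have hΦ2 : ContDiff ℝ 2 Φ := hΦs.of_le (by norm_num)
  obtain ⟨ℓ, hℓ⟩ := latitude_eq_clm (L := L) (fun e => (fundamentalRep (Fin 2) (g e) : Matrix (Fin 2) (Fin 2) ℂ))
  have hlatℓ : lat = ⇑ℓ := by funext y e; exact (hℓ y e).symm
  have hf3 : ContDiff ℝ 3 f := by
    rw [hf, hlatℓ]; exact (χ.contDiff (n := 3)).mul (hΦs.comp ℓ.contDiff)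
  have hfc : HasCompactSupport f := by rw [hf]; exact χ.hasCompactSupport.mul_right
  -- the cut-off is invisible near the group
  have hball : ∀ V : GaugeConfig 3 L (Matrix.specialUnitaryGroup (Fin 2) ℂ),
      coords V ∈ Metric.ball (0 : (Edge 3 L × Fin 2 × Fin 2 × Bool) → ℝ) 2 := by
    intro V
    rw [Metric.mem_ball, dist_zero_right]
    exact (norm_coords_le_one V).trans_lt (by norm_num)
  have hfeq : ∀ y ∈ Metric.ball (0 : (Edge 3 L × Fin 2 × Fin 2 × Bool) → ℝ) 2, f y = f₀ y := by
    intro y hy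
    have h1 : (χ : ((Edge 3 L × Fin 2 × Fin 2 × Bool) → ℝ) → ℝ) y = 1 :=
      χ.one_of_mem_closedBall (Metric.ball_subset_closedBall hy)
    simp only [hf, hf₀, h1, one_mul]
  have hfev : ∀ y ∈ Metric.ball (0 : (Edge 3 L × Fin 2 × Fin 2 × Bool) → ℝ) 2, f =ᶠ[𝓝 y] f₀ := fun y hy =>
    Filter.eventually_of_mem (Metric.isOpen_ball.mem_nhds hy) hfeq
  have hC1 : ∀ y ∈ Metric.ball (0 : (Edge 3 L × Fin 2 × Fin 2 × Bool) → ℝ) 2, fderiv ℝ f y = fderiv ℝ f₀ y :=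
    fun y hy => (hfev y hy).fderiv_eq
  have hC2 : ∀ y ∈ Metric.ball (0 : (Edge 3 L × Fin 2 × Fin 2 × Bool) → ℝ) 2, ∀ v,
      fderiv ℝ (fun z => fderiv ℝ f z v) y = fderiv ℝ (fun z => fderiv ℝ f₀ z v) y := by
    intro y hy v
    refine Filter.EventuallyEq.fderiv_eq ?_
    filter_upwards [Metric.isOpen_ball.mem_nhds hy] with z hz
    rw [hC1 z hz]
  -- values and generator of `f` at group points
  have hfval : ∀ V, f (coords V) = Obs V := by
    intro V
    rw [hfeq _ (hball V), hf₀, hObs]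
    have hG := (generator_latitude (L := L) 0 g V hΦ2).1
    dsimp only at hG
    show Φ (lat (coords V)) = Φ (Lat V)
    congr 1
  have hgen : ∀ V : GaugeConfig 3 L (Matrix.specialUnitaryGroup (Fin 2) ℂ),
      (∑ i, fderiv ℝ f (coords V) (Pi.single i 1) *
          (if i.2.2.2 = true then
            ((latticeLangevinDynamics (fundamentalLatticeRep 2) 0).drift
              (matrixConfig (fundamentalRep (Fin 2)) V) i.1 i.2.1 i.2.2.1).im
          else
            ((latticeLangevinDynamics (fundamentalLatticeRep 2) 0).drift
              (matrixConfig (fundamentalRep (Fin 2)) V) i.1 i.2.1 i.2.2.1).re) +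
        1 / 2 * ∑ i, ∑ j, fderiv ℝ (fun z => fderiv ℝ f z (Pi.single i 1)) (coords V) (Pi.single j 1) *
          ∑ n : Edge 3 L × NoiseIdx 2,
            ((if n.1 = i.1 then
                if i.2.2.2 = true then
                  ((latticeLangevinDynamics (fundamentalLatticeRep 2) 0).noise
                    (matrixConfig (fundamentalRep (Fin 2)) V) i.1 n.2 i.2.1 i.2.2.1).im
                else
                  ((latticeLangevinDynamics (fundamentalLatticeRep 2) 0).noise
                    (matrixConfig (fundamentalRep (Fin 2)) V) i.1 n.2 i.2.1 i.2.2.1).re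
              else 0) *
              if n.1 = j.1 then
                if j.2.2.2 = true then
                  ((latticeLangevinDynamics (fundamentalLatticeRep 2) 0).noise
                    (matrixConfig (fundamentalRep (Fin 2)) V) j.1 n.2 j.2.1 j.2.2.1).im
                else
                  ((latticeLangevinDynamics (fundamentalLatticeRep 2) 0).noise
                    (matrixConfig (fundamentalRep (Fin 2)) V) j.1 n.2 j.2.1 j.2.2.1).re
              else 0)) = -lam * Obs V := by
    intro V
    obtain ⟨hxs, hG⟩ := generator_latitude (L := L) 0 g V hΦ2
    dsimp only at hxs hG
    rw [hC1 _ (hball V)]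
    simp_rw [hC2 _ (hball V)]
    rw [hcoords]
    dsimp only
    rw [hG]
    have hdrift : ∀ e, hsForm (fundamentalLatticeRep 2).N ((fundamentalLatticeRep 2).ρ (g e))
        ((fundamentalLatticeRep 2).driftLie 0 (matrixConfig (fundamentalLatticeRep 2).ρ V) e *
          (fundamentalLatticeRep 2).ρ (V e)) / 2 = 0 := by
      intro e
      have h0 : (fundamentalLatticeRep 2).driftLie 0 (matrixConfig (fundamentalLatticeRep 2).ρ V) e = 0 := by
        unfold LatticeRep.driftLie; exact zero_smul ℝ _
      rw [h0, Matrix.zero_mul, map_zero, zero_div]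
    simp_rw [hdrift]
    rw [hΦ, jacobi_prod_gegenbauer m]
  -- continuity, measurability, bounds of the observable along the flow
  have hObs_cont : Continuous Obs := by
    have h := continuous_prod_gegenbauer_latitude (L := L) g m
    simpa only [hObs, hΦ, hLat] using h
  have hObs_meas : Measurable Obs := hObs_cont.measurable
  obtain ⟨M, hM0, hM⟩ := exists_abs_le_of_continuous hObs_cont
  have hjoint : Measurable fun p : Ω × ℝ => Obs (U x p.2.toNNReal p.1) := measurable_comp_flow_toNNReal hUm x hObs_meas
  have hmeas_t : ∀ r : ℝ≥0, Measurable fun ω => Obs (U x r ω) := fun r =>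
    hObs_meas.comp (((hU x).2.adapted r).mono (hW.natFiltration.le r) le_rfl)
  have hint_t : ∀ r : ℝ≥0, Integrable (fun ω => Obs (U x r ω)) P := fun r =>
    Integrable.of_bound (hmeas_t r).aestronglyMeasurable M (Eventually.of_forall fun ω => by
      rw [Real.norm_eq_abs]; exact hM _)
  -- the expectation as a function of real time
  set φ : ℝ → ℝ := fun r => ∫ ω, Obs (U x r.toNNReal ω) ∂P with hφ
  have hφm : Measurable φ := by
    have h := (hjoint.stronglyMeasurable).integral_prod_left' (μ := P)
    exact h.measurable
  have hφB : ∀ r, |φ r| ≤ M := by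
    intro r
    have h := norm_integral_le_of_norm_le_const (μ := P) (f := fun ω => Obs (U x r.toNNReal ω)) (C := M)
      (Eventually.of_forall fun ω => by rw [Real.norm_eq_abs]; exact hM _)
    rw [Real.norm_eq_abs] at h
    simpa using h
  -- explicit forms of `hfval`, `hgen` (no `coords` abbreviation), for rewriting Dynkin's formula
  rw [hcoords] at hfval hgen
  beta_reduce at hfval hgen
  -- Dynkin's formula ⇒ the integral equation
  have hZ : StronglyMeasurable[hW.natFiltration 0] (fun _ : Ω => (1 : ℝ)) := stronglyMeasurable_const
  have hDyn : ∀ τ : ℝ, 0 ≤ τ → φ τ = φ 0 - lam * ∫ u in Set.Ioc 0 τ, φ u := by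
    intro τ hτ
    set r : ℝ≥0 := τ.toNNReal with hr
    have hD := dynkin_expectation_szz L 0 hW U hU hUm x hf3 hfc (show (0 : ℝ≥0) ≤ r from bot_le) hZ (C := 1) (fun _ => by simp)
    dsimp only at hD
    simp_rw [one_mul, hfval, hgen] at hD
    -- left side
    have hL : ∫ ω, (Obs (U x r ω) - Obs (U x 0 ω)) ∂P = φ τ - φ 0 := by
      rw [integral_sub (hint_t r) (hint_t 0), hφ]
      simp only [hr, Real.toNNReal_zero]
    -- right side: Fubini
    have hR : ∫ ω, (∫ u in Set.Ioc (0 : ℝ) r, -lam * Obs (U x u.toNNReal ω)) ∂P =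
        -lam * ∫ u in Set.Ioc 0 τ, φ u := by
      have hrτ : ((r : ℝ≥0) : ℝ) = τ := by rw [hr, Real.coe_toNNReal τ hτ]
      rw [hrτ]
      have hI : Integrable (Function.uncurry fun (ω : Ω) (u : ℝ) => -lam * Obs (U x u.toNNReal ω))
          (P.prod (volume.restrict (Set.Ioc (0 : ℝ) τ))) := by
        refine Integrable.of_bound ?_ (|lam| * M) (Eventually.of_forall fun p => ?_)
        · exact ((measurable_const.mul hjoint).stronglyMeasurable).aestronglyMeasurable
        · rcases p with ⟨ω, u⟩
          rw [Function.uncurry_apply_pair, norm_mul, Real.norm_eq_abs, Real.norm_eq_abs, abs_neg]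
          exact mul_le_mul_of_nonneg_left (hM _) (abs_nonneg _)
      rw [integral_integral_swap hI]
      simp_rw [integral_const_mul]
      rfl
    rw [NNReal.coe_zero] at hD
    rw [hL, hR] at hD
    linarith
  -- solve the linear ODE
  have hsol := eq_mul_exp_of_integral_eq (c := φ 0) (lam := lam) hφm hφB (fun τ hτ => by
    have h := hDyn τ hτ; linarith) t t.2
  -- identify the two ends
  have h0 : φ 0 = Obs x := by
    simp only [hφ, Real.toNNReal_zero, (hU x).1, integral_const, smul_eq_mul, probReal_univ, one_mul]
  have ht : φ t = ∫ ω, Obs (U x t ω) ∂P := by simp only [hφ, Real.toNNReal_coe]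
  rw [ht, h0, mul_comm] at hsol
  simpa only [hObs, hΦ, hLat, hlam] using hsol

end Summit.QuantumFields.YangMills.Theorems.ColdStartUniversality

end
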